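import Literature.Computability.QuantumComplexity.SignedCubicForrelation
import Literature.Computability.QuantumComplexity.ForrelationMSubspaceDuality
import Literature.Computability.QuantumComplexity.ForrelationDirectSum

/-!
# McFarland's dual formula for exactly forrelated Maiorana–McFarland pairs

Helper file (stub `stub_dualShape`, line `dual-pingpong-frame`) for the crux
`SignedExactCubicForrelationNotPrBPP` of route `QuantumAdvantage/CubicForrelation`
(item stmt-QuantumAdvantage-13932).

Let `b : 𝔽₂^{m+m} → 𝔽₂` be a Maiorana–McFarland function, `b(y', y'') = y'·π(y'') ⊕ h(y'')` with `π` a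
PERMUTATION of `𝔽₂^m` (the inner product `y'·z` is the parity `(univ.filter fun i => y' i && z i).card.bodd`,
the halves are glued by `Fin.append`). If the pair `(a, b)` is exactly forrelated, `Φ(a,b) = ±1`, then `a`
is forced to be McFarland's dual of `b`, up to the global sign of `Φ`:

  `a(x', x'') = x''·π⁻¹(x') ⊕ h(π⁻¹(x')) ⊕ [Φ(a,b) = -1]`      (`stub_dualShape`).

Proof. (1) The Walsh transform of `(-1)^b` at `x = (x', x'')` is computed by splitting the sum over
`𝔽₂^{m+m}` along `Fin.appendEquiv`: the inner character sum `∑_{y'} (-1)^{y'·(π(y'') ⊕ x')}` is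
`2^m [π(y'') = x']`, leaving the single term `y'' = π⁻¹(x')`, so
`W_{(-1)^b}(x', x'') = 2^m (-1)^{h(π⁻¹ x')} (-1)^{x''·π⁻¹(x')}` (`W_signOf_maioranaMcFarland`).
(2) The pointwise duality of exactly forrelated pairs, `2ⁿ W_{(-1)^b}(x) = S · (-1)^{a(x)}` with
`S = √(2^{3n}) Φ = 2ⁿ 2^m Φ` (`DerivativeWalsh.two_pow_mul_W_eq`, `fsum_signOf_eq`), gives
`(-1)^{a(x)} = Φ · (-1)^{h(π⁻¹ x')} (-1)^{x''·π⁻¹(x')}`, which is the Boolean identity claimed.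

## References

* [Carlet2020] C. Carlet, Boolean Functions for Cryptography and Coding Theory, CUP 2021, Prop. 77
  (dual of a Maiorana–McFarland bent function).
* [Mesnager2016] S. Mesnager, Bent Functions: Fundamentals and Results, Springer 2016, Prop. 7.1.14.
* [AaronsonAmbainis2018] S. Aaronson, A. Ambainis, Forrelation, SIAM J. Comput. 47 (2018), §1.1.1.
-/

noncomputable section

set_option linter.dupNamespace false -- D-0017: single-problem summit ⇒ `QuantumAdvantage.QuantumAdvantage` by design

namespace Summit.QuantumAdvantage.QuantumAdvantage.Theorems.SignedExactCubicForrelationNotPrBPP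

open Finset
open Literature.Computability.Complexity Literature.Computability.QuantumComplexity
open Literature.Computability.QuantumComplexity.BuzetChailloux (bxor zeroVec)

/-! ### Small bridges: parities as signs -/

/-- `(-1)^{[n odd]} = (-1)^n`: the sign of the parity bit of `n`. [folklore] -/
theorem signOf_bodd (n : ℕ) : signOf n.bodd = (-1 : ℝ) ^ n := by
  induction n with
  | zero => simp [signOf]
  | succ n ih => rw [Nat.bodd_succ, DerivativeWalsh.signOf_not, ih, pow_succ]; ring

/-- The character `(-1)^{y·z}` (`twist y z`) is the sign of the parity of the overlap count
`#{i : yᵢ ∧ zᵢ}`. [folklore] -/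
theorem signOf_card_bodd {n : ℕ} (y z : Fin n → Bool) :
    signOf (univ.filter fun i => y i && z i).card.bodd = twist y z := by
  rw [signOf_bodd, Simon.twist_eq_neg_one_pow]

/-- Two Booleans with the same sign reading are equal. [folklore] -/
theorem eq_of_signOf_eq {p q : Bool} (h : signOf p = signOf q) : p = q := by
  revert h
  cases p <;> cases q <;> norm_num [signOf]

/-! ### The Walsh transform of a Maiorana–McFarland sign function -/

/-- **Walsh transform of a Maiorana–McFarland function.** For `b(y',y'') = y'·π(y'') ⊕ h(y'')` with `π`
a permutation, `W_{(-1)^b}(x', x'') = 2^m · (-1)^{h(π⁻¹ x')} · (-1)^{x''·π⁻¹(x')}`: the inner sum over `y'`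
is the character sum `∑_{y'} (-1)^{y'·(π(y'') ⊕ x')} = 2^m [π(y'') = x']`. [cite: Carlet2020, Prop. 77] -/
theorem W_signOf_maioranaMcFarland {m : ℕ} (b : (Fin (m + m) → Bool) → Bool)
    (π : (Fin m → Bool) ≃ (Fin m → Bool)) (h : (Fin m → Bool) → Bool)
    (hb : ∀ y' y'' : Fin m → Bool, b (Fin.append y' y'') =
      ((univ.filter fun i => y' i && (π y'') i).card.bodd ^^ h y''))
    (x' x'' : Fin m → Bool) :
    DerivativeWalsh.W (fun y => signOf (b y)) (Fin.append x' x'') =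
      (2 : ℝ) ^ m * (signOf (h (π.symm x')) * twist x'' (π.symm x')) := by
  simp only [DerivativeWalsh.W]
  rw [sum_append]
  have e1 : ∀ y' y'' : Fin m → Bool,
      signOf (b (Fin.append y' y'')) * twist (Fin.append y' y'') (Fin.append x' x'') =
        signOf (h y'') * twist y'' x'' * twist y' (bxor (π y'') x') := by
    intro y' y''
    rw [hb, signOf_xor, signOf_card_bodd, twist_append, BuzetChailloux.twist_bxor_right]
    ring
  simp_rw [e1]
  rw [sum_comm]
  simp_rw [← mul_sum, BuzetChailloux.sum_twist_left, BuzetChailloux.bxor_eq_zeroVec_iff,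
    Equiv.apply_eq_iff_eq_symm_apply, mul_ite, mul_zero, Finset.sum_ite_eq', mem_univ, ite_true]
  rw [twist_comm x'']
  ring

/-! ### McFarland's dual formula for exact pairs -/

/-- **McFarland's dual formula, for exactly forrelated pairs.** If `b(y',y'') = y'·π(y'') ⊕ h(y'')` is a
Maiorana–McFarland function on `𝔽₂^{m+m}` (`π` a permutation of `𝔽₂^m`) and `Φ(a,b) = ±1`, then
`a(x',x'') = x''·π⁻¹(x') ⊕ h(π⁻¹(x')) ⊕ [Φ(a,b) = -1]` for all `x', x''`: `a` is the dual bent function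
`b̃` of `b` when `Φ = 1` and its complement when `Φ = -1`. Proof: the Walsh transform
`W_{(-1)^b}(x',x'') = 2^m (-1)^{h(π⁻¹x') ⊕ x''·π⁻¹(x')}` (`W_signOf_maioranaMcFarland`) and the pointwise
duality `2ⁿ W_{(-1)^b} = √(2^{3n}) Φ · (-1)^a` of exact pairs (`DerivativeWalsh.two_pow_mul_W_eq`).
[cite: Carlet2020, Prop. 77] [cite: Mesnager2016, Prop. 7.1.14] -/
theorem stub_dualShape :
    ∀ (m : ℕ) (a b : (Fin (m + m) → Bool) → Bool) (π : (Fin m → Bool) ≃ (Fin m → Bool))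
    (h : (Fin m → Bool) → Bool),
    (∀ y' y'' : Fin m → Bool, b (Fin.append y' y'') = ((Finset.univ.filter fun i => y' i && (π y'') i).card.bodd ^^ h y'')) →
    (forrelation a b = 1 ∨ forrelation a b = -1) →
    ∀ x' x'' : Fin m → Bool,
      a (Fin.append x' x'') = ((Finset.univ.filter fun i => x'' i && (π.symm x') i).card.bodd ^^ h (π.symm x') ^^ decide (forrelation a b = -1)) := by
  intro m a b π h hb hΦ x' x''
  have hsq : forrelation a b ^ 2 = 1 := by
    rcases hΦ with e | e <;> rw [e] <;> norm_num
  -- pointwise duality `2ⁿ W_b(x) = S · (-1)^{a(x)}` at `x = (x', x'')`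
  have key := DerivativeWalsh.two_pow_mul_W_eq (fun x => signOf (a x)) (fun y => signOf (b y))
    (fun x => BuzetChailloux.signOf_sq (a x)) (fun y => BuzetChailloux.signOf_sq (b y))
    (DerivativeWalsh.fsum_signOf_sq_of_forrelation_sq a b hsq) (Fin.append x' x'')
  rw [W_signOf_maioranaMcFarland b π h hb x' x'', DerivativeWalsh.fsum_signOf_eq,
    DerivativeWalsh.sqrt_two_pow_three_mul] at key
  have hsqrt : Real.sqrt ((2 : ℝ) ^ (m + m)) = (2 : ℝ) ^ m := by
    rw [show (2 : ℝ) ^ (m + m) = ((2 : ℝ) ^ m) ^ 2 by ring, Real.sqrt_sq (by positivity)]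
  rw [hsqrt] at key
  -- cancel the positive factor `2^{m+m} · 2^m`
  have hpos : (0 : ℝ) < (2 : ℝ) ^ (m + m) * (2 : ℝ) ^ m := by positivity
  have key2 : signOf (h (π.symm x')) * twist x'' (π.symm x') =
      forrelation a b * signOf (a (Fin.append x' x'')) := by
    refine mul_left_cancel₀ hpos.ne' ?_
    linear_combination key
  -- the sign `[Φ = -1]` read through `signOf` is `Φ` itself
  have hdec : signOf (decide (forrelation a b = -1)) = forrelation a b := by
    rcases hΦ with e | e <;> rw [e] <;> norm_num [signOf]
  refine eq_of_signOf_eq ?_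
  rw [signOf_xor, signOf_xor, hdec, signOf_card_bodd]
  linear_combination (-forrelation a b) * key2 - signOf (a (Fin.append x' x'')) * hsq

end Summit.QuantumAdvantage.QuantumAdvantage.Theorems.SignedExactCubicForrelationNotPrBPP

end
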